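import Summits.ResolutionOfSingularities.ResolutionOfSingularities.Theorems.HomologicalConductorNoZenoExcCurveCount
import Literature.AlgebraicGeometry.Resolution.QuadraticTransforms
import Literature.AlgebraicGeometry.Resolution.Blowups
import HarnessLib

/-!
# Crux `NoZenoR` / `NoZeno` (stmt-ResolutionOfSingularities-19943 / -16483), β layer — U8a:
# the SPLIT exceptional count `N^s` (Lipman degree weights over the separable closure of the residue field)

Route `ResolutionOfSingularities/HomologicalConductor`.  OURS (cell res-hironaka, chain W4.4; object U8 of planner
res-L0-w44-plan-1 (ρ18b), source: res-L0-w44-idea-2 card `thread-nash` rev 1.3 ROUND 8b «(L1-w)», after J. Lipman,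
Publ. Math. IHÉS 36 (1969), §16 (16.1)/(16.3)/(16.5) pp. 231–235 and §27 (27.1)/(27.3) pp. 275–277); nothing here is
a statement of the manuscript under review, and nothing here asserts a Theses declaration.

Why.  Over a residue field `κ` that is not separably closed, a `κ`-irreducible exceptional curve `E_i` of the minimal
resolution of a normal surface germ may split over `κ^sep` into `[κ_i^s : κ]` curves, `κ_i^s :=` the separable
closure of `κ` in the function field `κ(E_i)`; the measure that drops under X¹-sandwiched blow-ups (idea-2's (L1-w),
example NS-A₂: `N : 1 → 1` but `N^s : 2 → 1`) is the SPLIT COUNT `N^s := Σ_i [κ_i^s : κ]` (= the number of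
exceptional curves over the strict henselisation), not the plain count `N` of U7 (`HasExcCurveCountLE`).

* `splitWeight π η := [separable closure of κ(π η) in κ(η) : κ(π η)]` — `κ(π η)` the residue field of the base
  point (for `η` in the closed fibre: the residue field `κ` of `R`), acting on `κ(η)` through Mathlib's
  `Scheme.Hom.residueFieldMap π η`; Mathlib `separableClosure`, `Module.finrank` (junk `0` if infinite — it is
  finite for the function field of an exceptional curve, not proved here).
* `splitExcCount π := ∑ᶠ η ∈ excCurvePoints π, splitWeight π η` (`finsum`; junk `0` on infinite support).
* `HasSplitExcCurveCountLE R N := ∃` minimal resolution `π` with `excCurvePoints π` finite and `splitExcCount π ≤ N`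
  («`N^s(R) ≤ N`»), the (R-w) measure slot of the measure-generic v24 descent skeleton (plan-1 (ρ18b)).

* U8b: `curveGerm z η h ⊆ κ(η)` (the reduced exceptional curve germ `𝒪_(E_η,z)` = image of `𝒪_(X,z) → κ(η)`),
  `IsBranchAt z η h V` (a proper valuation ring of `κ(η)` dominating the germ — a branch of `E_η` at `z`),
  `toBranch` / `isLocalHom_toBranch` (its local structure map), `branchSepDegree` (`[κ(V)^s : κ(z)]`, the number of
  geometric branches `V` carries), and **`sepNodes π`** = Lipman's node set 𝒩: closed-fibre points with at least two
  geometric branches of the exceptional curve (two distinct branch data, or one branch of separable degree `≥ 2`) —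
  typing (n1′) of STATUS 11:05Z, accepted by the planner (ρ19c); `toStalk` + **`IsSepX1Sandwiched R I`** = the
  (R-w) sandwich slot («I·𝒪_(X¹) invertible along the closed fibre, X¹ = the minimal resolution blown up at the
  closure of `sepNodes`», (ρ19a) (r2)). [cite: Lipman1969, §16 (16.1) (p. 231) and §27 (27.3) (p. 277)]
-/

noncomputable section

-- single-problem summit: the doubled namespace component `ResolutionOfSingularities` is forced
set_option linter.dupNamespace false

namespace Summit.ResolutionOfSingularities.ResolutionOfSingularities.Theorems.NoZeno.ExcCount

open CategoryTheory AlgebraicGeometry IsLocalRing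
open Literature.AlgebraicGeometry.Resolution

/-- The **split weight** of a point `η` of an `R`-scheme `π : X → Spec R`: the degree over the residue field
`κ(π η)` of the separable closure of `κ(π η)` in `κ(η)` — for the generic point of a `κ`-irreducible exceptional curve
`E`, the number of curves `E` splits into over `κ^sep`. (`κ(π η)` acts on `κ(η)` through `π.residueFieldMap η`.)
JUNK GUARD (planner (ρ19a) (r1)): the weight is `max 1 (finrank …)`, so it is `≥ 1` by DEFINITION and equals
Lipman's weight whenever the separable closure is finite-dimensional (always the case for an exceptional curve of a
resolution of an essentially-finite-type surface germ — not proved here); in particular `N ≤ N^s` and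
«`N^s = 0` ⇒ no exceptional curve» hold without any finiteness input. [cite: Lipman1969, §16 (16.1) (p. 231)] -/
def splitWeight {R : Type} [CommRing R] {X : Scheme.{0}} (π : X ⟶ Spec (.of R)) (η : X) : ℕ :=
  letI := (π.residueFieldMap η).hom.toAlgebra
  max 1 (Module.finrank ((Spec (.of R)).residueField (π.base η))
    (separableClosure ((Spec (.of R)).residueField (π.base η)) (X.residueField η)))

/-- The **split exceptional count** `N^s(π) = Σ_η splitWeight π η` over the integral exceptional curves
`η ∈ excCurvePoints π` (`finsum`: junk `0` if there are infinitely many). [cite: Lipman1969, §27 (27.3) (p. 277)] -/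
def splitExcCount {R : Type} [CommRing R] [IsLocalRing R] {X : Scheme.{0}} (π : X ⟶ Spec (.of R)) : ℕ :=
  ∑ᶠ η ∈ excCurvePoints π, splitWeight π η

/-- **`N^s(R) ≤ N`**: some minimal resolution of `Spec R` has finitely many integral exceptional curves with split
count `≤ N` — the (R-w) measure of idea-2's (L1-w) (card thread-nash rev 1.3), replacing the plain count of
`HasExcCurveCountLE` (U7) over non-separably-closed residue fields. [this work] -/
def HasSplitExcCurveCountLE (R : Type) [CommRing R] [IsLocalRing R] (N : ℕ) : Prop :=
  ∃ (X : Scheme.{0}) (π : X ⟶ Spec (.of R)), IsMinimalResolution π ∧ (excCurvePoints π).Finite ∧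
    splitExcCount π ≤ N

/-- Unfolding lemma. [this work] -/
theorem hasSplitExcCurveCountLE_iff (R : Type) [CommRing R] [IsLocalRing R] (N : ℕ) :
    HasSplitExcCurveCountLE R N ↔ ∃ (X : Scheme.{0}) (π : X ⟶ Spec (.of R)), IsMinimalResolution π ∧
      (excCurvePoints π).Finite ∧ splitExcCount π ≤ N :=
  Iff.rfl

/-- Monotonicity in the bound. [this work] -/
theorem hasSplitExcCurveCountLE_mono {R : Type} [CommRing R] [IsLocalRing R] {N N' : ℕ} (h : N ≤ N')
    (hN : HasSplitExcCurveCountLE R N) : HasSplitExcCurveCountLE R N' := by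
  obtain ⟨X, π, hπ, hfin, hle⟩ := hN
  exact ⟨X, π, hπ, hfin, hle.trans h⟩

/-- With no exceptional curves the split count is `0`. [this work] -/
theorem splitExcCount_eq_zero_of_excCurvePoints_eq_empty {R : Type} [CommRing R] [IsLocalRing R]
    {X : Scheme.{0}} (π : X ⟶ Spec (.of R)) (h : excCurvePoints π = ∅) : splitExcCount π = 0 := by
  simp [splitExcCount, h]

/-- `1 ≤ splitWeight` (junk guard). [this work] -/
theorem one_le_splitWeight {R : Type} [CommRing R] {X : Scheme.{0}} (π : X ⟶ Spec (.of R)) (η : X) :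
    1 ≤ splitWeight π η :=
  le_max_left _ _

/-- **`N ≤ N^s`**: the plain exceptional count is at most the split count (finitely many curves). [this work] -/
theorem ncard_le_splitExcCount {R : Type} [CommRing R] [IsLocalRing R] {X : Scheme.{0}}
    (π : X ⟶ Spec (.of R)) (hfin : (excCurvePoints π).Finite) :
    (excCurvePoints π).ncard ≤ splitExcCount π := by
  classical
  rw [splitExcCount, finsum_mem_eq_finite_toFinset_sum _ hfin, Set.ncard_eq_toFinset_card _ hfin,
    Finset.card_eq_sum_ones]
  exact Finset.sum_le_sum fun η _ => one_le_splitWeight π η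

/-- A regular local ring has split count `0` (its own minimal resolution, no exceptional curves — U7's
`excCurvePoints_id_eq_empty`, `isMinimalResolution_id`). [this work] -/
theorem hasSplitExcCurveCountLE_zero_of_isRegularLocalRing (R : Type) [CommRing R] [IsRegularLocalRing R] :
    HasSplitExcCurveCountLE R 0 := by
  obtain ⟨X, π, hπ, hfin, hcard⟩ := hasExcCurveCountLE_zero_of_isRegularLocalRing R
  refine ⟨X, π, hπ, hfin, ?_⟩
  have h0 : excCurvePoints π = ∅ := (Set.ncard_eq_zero hfin).mp (Nat.le_zero.mp hcard)
  rw [splitExcCount_eq_zero_of_excCurvePoints_eq_empty π h0]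

/-- **Split count bounds plain count**: `HasSplitExcCurveCountLE R N → HasExcCurveCountLE R N` (same minimal
resolution; `N ≤ N^s`). So U7's (L0) «count `0` ⇒ regular» (`Thread.isRegularLocalRing_of_hasExcCurveCountLE_zero`)
transfers verbatim to the split count. [this work] -/
theorem hasExcCurveCountLE_of_hasSplitExcCurveCountLE {R : Type} [CommRing R] [IsLocalRing R] {N : ℕ}
    (h : HasSplitExcCurveCountLE R N) : HasExcCurveCountLE R N := by
  obtain ⟨X, π, hπ, hfin, hle⟩ := h
  exact ⟨X, π, hπ, hfin, (ncard_le_splitExcCount π hfin).trans hle⟩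

/-! ## U8b — the κ^sep-NODES of the exceptional curve (branches of the reduced exceptional curves) -/

section Nodes

variable {X : Scheme.{0}}

/-- The **reduced exceptional curve germ** `𝒪_(E_η, z) ⊆ κ(η)`: for a specialisation `η ⤳ z`, the image of
`𝒪_(X,z) → 𝒪_(X,η) → κ(η)` (the local ring at `z` of the integral curve `closure {η}` with its reduced structure,
inside its function field `κ(η)`). [cite: Lipman1969, §16 (16.1) (p. 231)] -/
def curveGerm (z η : X) (h : η ⤳ z) : Subring (X.residueField η) :=
  ((X.residue η).hom.comp (X.presheaf.stalkSpecializes h).hom).range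

/-- A **branch** of the curve `closure {η}` at `z`: a proper valuation ring of the function field `κ(η)`
dominating the curve germ `𝒪_(E_η, z)` (tree `SubringDominates`: contained, and units of `V` lying in the germ
are units of the germ). [cite: Lipman1969, §16 (16.1) (p. 231)] -/
def IsBranchAt (z η : X) (h : η ⤳ z) (V : ValuationSubring (X.residueField η)) : Prop :=
  V ≠ ⊤ ∧ SubringDominates (curveGerm z η h) V.toSubring

/-- The structure map `𝒪_(X,z) → V` of a branch (codomain restriction of `𝒪_(X,z) → κ(η)`). [this work] -/
def toBranch (z η : X) (h : η ⤳ z) (V : ValuationSubring (X.residueField η)) (hb : IsBranchAt z η h V) :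
    X.presheaf.stalk z →+* V :=
  ((X.residue η).hom.comp (X.presheaf.stalkSpecializes h).hom).codRestrict V.toSubring
    (fun s => hb.2.1 ⟨s, rfl⟩)

/-- The structure map of a branch is a LOCAL homomorphism (domination). [this work] -/
theorem isLocalHom_toBranch (z η : X) (h : η ⤳ z) (V : ValuationSubring (X.residueField η))
    (hb : IsBranchAt z η h V) : IsLocalHom (toBranch z η h V hb) := by
  set f : X.presheaf.stalk z →+* X.residueField η :=
    (X.residue η).hom.comp (X.presheaf.stalkSpecializes h).hom with hf
  refine ⟨fun s hs => ?_⟩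
  -- the image `f s` is a unit of `V`, hence (domination) a unit of the germ
  have hcoe : ((toBranch z η h V hb s : V) : X.residueField η) = f s := rfl
  have hfs_mem : f s ∈ curveGerm z η h := ⟨s, rfl⟩
  obtain ⟨u, hu⟩ := hs
  have hne : (f s) ≠ 0 := by
    intro h0
    have : (u : V) = 0 := Subtype.ext (by rw [hu, hcoe, h0]; rfl)
    exact u.ne_zero this
  have hinvV : (f s)⁻¹ ∈ V.toSubring := by
    have : ((↑(u⁻¹) : V) : X.residueField η) = (f s)⁻¹ := by
      rw [← hcoe, ← hu]
      have hmul : ((u : V) : X.residueField η) * ((↑(u⁻¹) : V) : X.residueField η) = 1 := by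
        rw [← Subring.coe_mul V.toSubring]
        change (((u * u⁻¹ : Vˣ) : V) : X.residueField η) = 1
        simp
      exact (eq_inv_of_mul_eq_one_right hmul)
    rw [← this]; exact (↑(u⁻¹) : V).2
  have hinvG : (f s)⁻¹ ∈ curveGerm z η h := hb.2.2 _ hfs_mem hinvV
  obtain ⟨s', hs'⟩ := hinvG
  -- `f (s * s') = 1`, so `s` is a unit of the local ring `𝒪_(X,z)`
  by_contra hsu
  have hmem : s * s' ∈ nonunits (X.presheaf.stalk z) := fun hss => hsu (isUnit_of_mul_isUnit_left hss)
  have hunit : IsUnit (1 - s * s') := IsLocalRing.isUnit_one_sub_self_of_mem_nonunits _ hmem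
  have hzero : f (1 - s * s') = 0 := by
    rw [map_sub, map_one, map_mul]
    change (1 : X.residueField η) - f s * f s' = 0
    rw [show f s' = (f s)⁻¹ from hs', mul_inv_cancel₀ hne, sub_self]
  exact (hunit.map f).ne_zero hzero

/-- The **separable degree of a branch** over `κ(z)`: `[κ(V)^s : κ(z)]`, `κ(V)^s` the separable closure of the
residue field `κ(z)` in the residue field of the branch `V` (`κ(z) → κ(V)` through the local structure map
`𝒪_(X,z) → V`). Over `κ(z)^sep` the branch `V` splits into this many geometric branches.
[cite: Lipman1969, §16 (16.1), (16.5) (pp. 231–235)] -/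
def branchSepDegree (z η : X) (h : η ⤳ z) (V : ValuationSubring (X.residueField η))
    (hb : IsBranchAt z η h V) : ℕ :=
  letI := isLocalHom_toBranch z η h V hb
  letI : Algebra (X.residueField z) (IsLocalRing.ResidueField V) :=
    (IsLocalRing.ResidueField.map (toBranch z η h V hb)).toAlgebra
  Module.finrank (X.residueField z) (separableClosure (X.residueField z) (IsLocalRing.ResidueField V))

variable {R : Type} [CommRing R] [IsLocalRing R]

/-- A branch DATUM at `z` of the exceptional fibre of `π : X → Spec R`: an integral exceptional curve `η` through
`z` together with a branch of it at `z`. [this work] -/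
def IsExcBranch (π : X ⟶ Spec (.of R)) (z : X) (b : Σ η : X, ValuationSubring (X.residueField η)) : Prop :=
  b.1 ∈ excCurvePoints π ∧ ∃ h : b.1 ⤳ z, IsBranchAt z b.1 h b.2

/-- The **κ^sep-NODES** of the exceptional fibre of `π : X → Spec R` (Lipman's node set 𝒩, idea-2 (L1-w)): the
points `z` over the closed point through which pass at least two GEOMETRIC branches of the exceptional curve — either
two distinct branches (of the same or of different integral exceptional curves), or one branch of separable residue
degree `≥ 2` over `κ(z)`.  Contains the (x1) node set «points on two `κ`-curves» and, e.g., the base point `q` of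
NS-A₂ (one `κ`-curve, one branch with `[κ(V):κ(q)]_s = 2`). [cite: Lipman1969, §16 (16.1) (p. 231)] -/
def sepNodes (π : X ⟶ Spec (.of R)) : Set X :=
  {z : X | π.base z = closedPoint R ∧
    ((∃ b b' : Σ η : X, ValuationSubring (X.residueField η), b ≠ b' ∧ IsExcBranch π z b ∧ IsExcBranch π z b') ∨
      (∃ (η : X) (h : η ⤳ z) (V : ValuationSubring (X.residueField η)) (hb : IsBranchAt z η h V),
        η ∈ excCurvePoints π ∧ 2 ≤ branchSepDegree z η h V hb))}

/-- Unfolding lemma for `sepNodes`. [this work] -/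
theorem mem_sepNodes_iff (π : X ⟶ Spec (.of R)) (z : X) :
    z ∈ sepNodes π ↔ π.base z = closedPoint R ∧
      ((∃ b b' : Σ η : X, ValuationSubring (X.residueField η), b ≠ b' ∧ IsExcBranch π z b ∧ IsExcBranch π z b') ∨
        (∃ (η : X) (h : η ⤳ z) (V : ValuationSubring (X.residueField η)) (hb : IsBranchAt z η h V),
          η ∈ excCurvePoints π ∧ 2 ≤ branchSepDegree z η h V hb)) :=
  Iff.rfl

/-- The structure map `R → 𝒪_(Y,y)` of a point of an `R`-scheme `f : Y → Spec R` (the ring-hom expression of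
THEOREM A `stub_caInvertibleMinRes`; same text as the (L1)-SIG sketch). [this work] -/
def toStalk {R : Type} [CommRing R] {Y : Scheme.{0}} (f : Y ⟶ Spec (.of R)) (y : Y) :
    R →+* Y.presheaf.stalk y :=
  ((Y.presheaf.germ ⊤ y trivial).hom.comp (f.appTop.hom.comp (Scheme.ΓSpecIso (.of R)).inv.hom))

/-- **«`I` is X¹-sandwiched» over the κ^sep-NODES** (the (R-w) sandwich slot `𝓢` of the measure-generic β2
descent, planner v24-draft b7b70f23d19c102e; the (x1) text of the (L1)-SIG with `nodes ↦ sepNodes` and `R`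
explicit): for SOME minimal resolution `π : X → Spec R` and SOME blow-up `ρ : X¹ → X` of (the vanishing ideal sheaf
of the closure of) the node set `sepNodes π`, the ideal `I·𝒪_(X¹,x₁)` is principal at every point `x₁` of `X¹` over
the closed point of `R`. [this work; idea-2 card thread-nash rev 1.3 (L1-w)/(T-X¹)] -/
def IsSepX1Sandwiched (R : Type) [CommRing R] [IsLocalRing R] (I : Ideal R) : Prop :=
  ∃ (X : Scheme.{0}) (π : X ⟶ Spec (.of R)) (_ : IsMinimalResolution π) (X1 : Scheme.{0}) (ρ : X1 ⟶ X),
    IsBlowup ρ (Scheme.IdealSheafData.vanishingIdeal ⟨closure (sepNodes π), isClosed_closure⟩) ∧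
    ∀ x₁ : X1, IsLocalHom (toStalk (ρ ≫ π) x₁) → (I.map (toStalk (ρ ≫ π) x₁)).IsPrincipal

end Nodes

end Summit.ResolutionOfSingularities.ResolutionOfSingularities.Theorems.NoZeno.ExcCount

end
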